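import Summits.NavierStokesRegularity.NavierStokesRegularity.Theorems.EulerZoomLiouvillePowerGaugeEulerLiouvilleBreatherWeakLEITools

/-!
# Crux `EulerZoomLiouville.PowerGaugeEulerLiouville` (stmt-NavierStokesRegularity-19832), line `logtime-breathers` (T3, weak residue):
# the ONE-SIDED PROFILE ENERGY INEQUALITY of a WEAK log-time breather — the local energy inequality tested with a CO-MOVING cut-off

Width seat `ns-ezl-w4` (g3; weak breather rigidity, file C — the lever).  Let `(u, p)` be a SUITABLE WEAK Euler pair on the slab `(−∞,0) × ℝ³`
(CKN local energy inequality (2.5), no force) of exact breather form `u(τ, y) = e^{cτ} V(e^{−cτ} y)`, `p(τ, y) = (e^{cτ})² Q(e^{−cτ} y)` for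
`τ < 0` (any real `c`; the pressure clause is free by ns-ezl-w3's breather pressure slaving), with `|V|², |V|³, |Q||V| ∈ L¹_loc`.  Then for every
nonnegative test function `σ` and every scale `L > 0`, with `σ_L = σ(L⁻¹·)`,

  `5c ∫ σ_L |V|² + c ∫ |V|² ⟪z, ∇σ_L⟫ ≤ ∫ (|V|² + 2Q) ⟪V, ∇σ_L⟫`                                  (`profile_energy_le`)

— the breather profile local energy relation `(κβ) I_σ(L) = F_σ(L) + β J_σ(L)` of the classical theory (`(α, β) = (c, −c)`, `κ = −5`,
`ClassicalProfile.local_energy_equality`) in the ONE direction the local energy INEQUALITY provides.  Proof: test CKN (2.5) with the CO-MOVING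
cut-off `φ(τ, y) = e^{−5cτ} χ(τ) σ_L(e^{−cτ} y)` (`χ` a smooth time bump in `(−2,−1)`): at each time the space integral is, after `y = e^{cτ} z`,
`χ'(τ) I_σ(L) − 5c χ(τ) I_σ(L) − c χ(τ) J_σ(L) + χ(τ) F_σ(L)` (no Fubini: the inequality is already iterated), and `∫ χ' = 0`.
For `c > 0` (`β = −c < 0`) this is exactly the input `hLE` of `WeakProfile.ae_eq_zero_of_locData_of_scaleIneq` (file A).

* `BreatherWeak.profile_energy_le` — the inequality above (tools: `…BreatherWeakLEITools`).

WHAT THIS IS NOT: not NS regularity, not the crux — the lever of the WEAK breather-rigidity member (sequel `…BreatherWeakRigidity`);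
`--supports` stmt-19832. [folklore; cf. CaffarelliKohnNirenberg1982 §2 (2.5), ChaeShvydkoy2013 §2.2]
-/

noncomputable section

set_option linter.dupNamespace false

open MeasureTheory Set Filter Topology Metric Function TopologicalSpace
open scoped ENNReal NNReal RealInnerProductSpace ContDiff Laplacian

namespace Summit.NavierStokesRegularity.NavierStokesRegularity.Theorems.PowerGaugeEulerLiouville

open Literature.Analysis Literature.Analysis.FunctionSpaces Literature.Analysis.FluidPDE

namespace BreatherWeak

variable {u : ℝ → EuclideanSpace ℝ (Fin 3) → EuclideanSpace ℝ (Fin 3)} {p : ℝ → EuclideanSpace ℝ (Fin 3) → ℝ}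
  {c : ℝ} {V : EuclideanSpace ℝ (Fin 3) → EuclideanSpace ℝ (Fin 3)} {Q : EuclideanSpace ℝ (Fin 3) → ℝ}
  {σ : EuclideanSpace ℝ (Fin 3) → ℝ}

/-! ### The one-sided profile energy inequality -/

/-- **THE ONE-SIDED PROFILE ENERGY INEQUALITY OF A WEAK LOG-TIME BREATHER.**  Let `(u, p)` be a suitable weak Euler pair on the slab
`(−∞,0) × ℝ³` with `u(τ, y) = e^{cτ} V(e^{−cτ} y)` and `p(τ, y) = (e^{cτ})² Q(e^{−cτ} y)` for all `τ < 0`, where `V`, `Q` are a.e.-strongly measurable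
with `|V|², |V|³, |Q||V| ∈ L¹_loc`.  Then for every nonnegative test function `σ` and every `L > 0`
`(−5)(−c) ∫σ(L⁻¹y)|V|² ≤ ∫(|V|²+2Q)⟪V,∇σ_L⟫ + (−c) ∫|V|²⟪y,∇σ_L⟫`, i.e. `5c I_σ(L) + c J_σ(L) ≤ F_σ(L)` — CKN (2.5) tested with the
co-moving cut-off `e^{−5cτ}χ(τ)σ_L(e^{−cτ}y)`.  (The shape is `hLE` of `WeakProfile.ae_eq_zero_of_locData_of_scaleIneq` with `κ = −5`, `β = −c`.)
[folklore; cf. CaffarelliKohnNirenberg1982 §2 (2.5)] -/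
theorem profile_energy_le
    (hsw : IsSuitableWeakSolutionOn (slab (EuclideanSpace ℝ (Fin 3)) (Iio 0) isOpen_Iio) 0 0 u p)
    (hbr : ∀ τ : ℝ, τ < 0 → ∀ y, u τ y = Real.exp (c * τ) • V (Real.exp (-(c * τ)) • y))
    (hp : ∀ τ : ℝ, τ < 0 → ∀ y, p τ y = Real.exp (c * τ) ^ 2 * Q (Real.exp (-(c * τ)) • y))
    (hVm : AEStronglyMeasurable V volume) (hQm : AEStronglyMeasurable Q volume)
    (hV2 : LocallyIntegrable (fun y => ‖V y‖ ^ 2) volume)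
    (hV3 : LocallyIntegrable (fun y => ‖V y‖ ^ 3) volume)
    (hQV : LocallyIntegrable (fun y => |Q y| * ‖V y‖) volume)
    (hσ : IsTestFunctionOn (⊤ : Opens (EuclideanSpace ℝ (Fin 3))) σ) (hσ0 : ∀ z, 0 ≤ σ z)
    {L : ℝ} (hL : 0 < L) :
    (-5) * (-c) * ∫ x, σ (L⁻¹ • x) * ‖V x‖ ^ 2 ≤
      (∫ x, (‖V x‖ ^ 2 + 2 * Q x) * ⟪V x, gradient (fun z => σ (L⁻¹ • z)) x⟫) +
        (-c) * ∫ x, ‖V x‖ ^ 2 * ⟪x, gradient (fun z => σ (L⁻¹ • z)) x⟫ := by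
  -- ### notation: the rescaled cut-off, the three profile integrals
  set σL : EuclideanSpace ℝ (Fin 3) → ℝ := fun z => σ (L⁻¹ • z) with hσLdef
  have hσL : IsTestFunctionOn (⊤ : Opens (EuclideanSpace ℝ (Fin 3))) σL :=
    EnergySaturation.isTestFunctionOn_comp_inv_smul hσ hL.ne'
  have hσLs : ContDiff ℝ (⊤ : ℕ∞) σL := hσL.contDiff
  have hσLd : Differentiable ℝ σL := hσLs.differentiable (by simp)
  have hσL1 : ContDiff ℝ 1 σL := hσLs.of_le (by exact_mod_cast le_top)
  set gL : EuclideanSpace ℝ (Fin 3) → EuclideanSpace ℝ (Fin 3) := gradient σL with hgLdef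
  have hgLc : Continuous gL := continuous_gradient_of_contDiff hσL1
  set N : ℝ := ∫ x, σL x * ‖V x‖ ^ 2 with hN
  set J : ℝ := ∫ x, ‖V x‖ ^ 2 * ⟪x, gL x⟫ with hJ
  set F : ℝ := ∫ x, (‖V x‖ ^ 2 + 2 * Q x) * ⟪V x, gL x⟫ with hF
  have hNi : Integrable (fun x => σL x * ‖V x‖ ^ 2) volume := integrable_cutoff_sq hσ hV2 hL
  have hJi : Integrable (fun x => ‖V x‖ ^ 2 * ⟪x, gL x⟫) volume := integrable_sq_inner_gradient hσ hV2 hL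
  have hFi : Integrable (fun x => (‖V x‖ ^ 2 + 2 * Q x) * ⟪V x, gL x⟫) volume :=
    integrable_flux hσ hVm hQm hV3 hQV hL
  -- support radius of `σL`
  obtain ⟨R₀, hR₀⟩ := hσL.hasCompactSupport.isCompact.isBounded.subset_closedBall (0 : EuclideanSpace ℝ (Fin 3))
  set Rσ : ℝ := max R₀ 1 with hRσ
  have hRσ0 : 0 < Rσ := lt_of_lt_of_le one_pos (le_max_right _ _)
  have hσLR : ∀ z, Rσ < ‖z‖ → σL z = 0 := by
    intro z hz
    refine image_eq_zero_of_notMem_tsupport fun h => ?_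
    have := hR₀ h
    rw [mem_closedBall, dist_zero_right] at this
    linarith [le_max_left R₀ 1]
  -- ### the time bump and the time factor `η(t) = e^{-5ct} χ(t)`
  obtain ⟨χ, hχs, hχ0, hχsupp, hχpos, hχi, hχ'i, hχ'0⟩ := exists_timeBump
  have hχ1 : ContDiff ℝ 1 χ := hχs.of_le (by exact_mod_cast le_top)
  have hχd : ∀ t, HasDerivAt χ (deriv χ t) t := fun t => (hχ1.differentiable one_ne_zero t).hasDerivAt
  have hχ'supp : ∀ t, t ∉ Icc (-7/4 : ℝ) (-5/4) → deriv χ t = 0 := by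
    intro t ht
    have hopen : IsOpen (Icc (-7/4 : ℝ) (-5/4))ᶜ := isClosed_Icc.isOpen_compl
    have hev : (fun s => χ s) =ᶠ[𝓝 t] fun _ => (0 : ℝ) := by
      filter_upwards [hopen.mem_nhds ht] with s hs
      exact hχsupp s hs
    rw [hev.deriv_eq, deriv_const]
  set η : ℝ → ℝ := fun t => Real.exp (-(5 * c * t)) * χ t with hηdef
  set η' : ℝ → ℝ := fun t => -(5 * c) * Real.exp (-(5 * c * t)) * χ t + Real.exp (-(5 * c * t)) * deriv χ t with hη'def
  have hηd : ∀ t, HasDerivAt η (η' t) t := by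
    intro t
    have h1 : HasDerivAt (fun s => Real.exp (-(5 * c * s))) (Real.exp (-(5 * c * t)) * (-(5 * c))) t := by
      have := ((hasDerivAt_id t).const_mul (5 * c)).neg.exp
      simpa using this
    have h := h1.mul (hχd t)
    refine h.congr_deriv ?_
    simp only [hη'def]; ring
  have hηs : ContDiff ℝ (⊤ : ℕ∞) η :=
    ((contDiff_const.mul contDiff_id).neg.exp).mul hχs
  have hη0 : ∀ t, 0 ≤ η t := fun t => mul_nonneg (Real.exp_pos _).le (hχ0 t)
  have hηsupp : ∀ t, t ∉ Icc (-7/4 : ℝ) (-5/4) → η t = 0 := fun t ht => by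
    simp only [hηdef, hχsupp t ht, mul_zero]
  have hη'supp : ∀ t, t ∉ Icc (-7/4 : ℝ) (-5/4) → η' t = 0 := fun t ht => by
    simp only [hη'def, hχsupp t ht, hχ'supp t ht, mul_zero, add_zero]
  -- `e^{5ct} η = χ`, `e^{5ct} η' = χ' - 5c χ`
  have hEη : ∀ t, Real.exp (c * t) ^ 5 * η t = χ t := by
    intro t
    simp only [hηdef]
    rw [← mul_assoc, ← Real.exp_nat_mul, ← Real.exp_add]
    push_cast
    rw [show (5 : ℝ) * (c * t) + -(5 * c * t) = 0 by ring, Real.exp_zero, one_mul]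
  have hEη' : ∀ t, Real.exp (c * t) ^ 5 * η' t = deriv χ t - 5 * c * χ t := by
    intro t
    simp only [hη'def]
    have e5 : Real.exp (c * t) ^ 5 * Real.exp (-(5 * c * t)) = 1 := by
      rw [← Real.exp_nat_mul, ← Real.exp_add]
      push_cast
      rw [show (5 : ℝ) * (c * t) + -(5 * c * t) = 0 by ring, Real.exp_zero]
    calc Real.exp (c * t) ^ 5 * (-(5 * c) * Real.exp (-(5 * c * t)) * χ t + Real.exp (-(5 * c * t)) * deriv χ t)
        = (Real.exp (c * t) ^ 5 * Real.exp (-(5 * c * t))) * (deriv χ t - 5 * c * χ t) := by ring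
      _ = deriv χ t - 5 * c * χ t := by rw [e5, one_mul]
  -- ### the co-moving test function
  set D : ℝ → ℝ := fun t => Real.exp (-(c * t)) with hDdef
  have hD0 : ∀ t, 0 < D t := fun t => Real.exp_pos _
  set φ : ℝ → EuclideanSpace ℝ (Fin 3) → ℝ := fun t x => η t * σL (D t • x) with hφdef
  -- smoothness
  have hΨ : ContDiff ℝ (⊤ : ℕ∞) fun z : ℝ × EuclideanSpace ℝ (Fin 3) => D z.1 • z.2 :=
    ((contDiff_const.mul contDiff_fst).neg.exp).smul contDiff_snd
  have hφs : ContDiff ℝ (⊤ : ℕ∞) (uncurry φ) := by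
    have h1 : ContDiff ℝ (⊤ : ℕ∞) fun z : ℝ × EuclideanSpace ℝ (Fin 3) => η z.1 := hηs.comp contDiff_fst
    have h2 : ContDiff ℝ (⊤ : ℕ∞) fun z : ℝ × EuclideanSpace ℝ (Fin 3) => σL (D z.1 • z.2) := hσLs.comp hΨ
    exact h1.mul h2
  -- compact support inside the slab
  set R' : ℝ := Rσ * Real.exp (2 * |c|) with hR'
  set K : Set (ℝ × EuclideanSpace ℝ (Fin 3)) := Icc (-2 : ℝ) (-1) ×ˢ closedBall (0 : EuclideanSpace ℝ (Fin 3)) R' with hK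
  have hKc : IsCompact K := isCompact_Icc.prod (isCompact_closedBall _ _)
  have hφK : ∀ z : ℝ × EuclideanSpace ℝ (Fin 3), z ∉ K → uncurry φ z = 0 := by
    rintro ⟨t, x⟩ hz
    simp only [uncurry, hφdef]
    by_cases ht : t ∈ Icc (-2 : ℝ) (-1)
    · have hx : x ∉ closedBall (0 : EuclideanSpace ℝ (Fin 3)) R' := fun h => hz (mem_prod.2 ⟨ht, h⟩)
      rw [mem_closedBall, dist_zero_right, not_le] at hx
      have hct : -(c * t) ≥ -(2 * |c|) := by
        have : |c * t| ≤ 2 * |c| := by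
          rw [abs_mul]
          have : |t| ≤ 2 := by rw [abs_le]; constructor <;> linarith [ht.1, ht.2]
          nlinarith [abs_nonneg c]
        linarith [le_abs_self (c * t)]
      have hDt : Real.exp (-(2 * |c|)) ≤ D t := by rw [hDdef, Real.exp_le_exp]; linarith
      have hnorm : Rσ < ‖D t • x‖ := by
        rw [norm_smul, Real.norm_eq_abs, abs_of_pos (hD0 t)]
        have h1 : Real.exp (-(2 * |c|)) * R' = Rσ := by
          rw [hR', show Real.exp (-(2 * |c|)) * (Rσ * Real.exp (2 * |c|)) = Rσ * (Real.exp (-(2 * |c|)) * Real.exp (2 * |c|)) by ring,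
            ← Real.exp_add, neg_add_cancel, Real.exp_zero, mul_one]
        rw [← h1]
        calc Real.exp (-(2 * |c|)) * R' < Real.exp (-(2 * |c|)) * ‖x‖ := mul_lt_mul_of_pos_left hx (Real.exp_pos _)
          _ ≤ D t * ‖x‖ := mul_le_mul_of_nonneg_right hDt (norm_nonneg _)
      rw [hσLR _ hnorm, mul_zero]
    · have ht' : t ∉ Icc (-7/4 : ℝ) (-5/4) := fun h => ht ⟨by linarith [h.1], by linarith [h.2]⟩
      rw [hηsupp t ht', zero_mul]
  have hφcs : HasCompactSupport (uncurry φ) := HasCompactSupport.intro hKc hφK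
  have hφT : IsSpaceTimeTestOn (slab (EuclideanSpace ℝ (Fin 3)) (Iio 0) isOpen_Iio) φ := by
    refine ⟨hφs, hφcs, ?_⟩
    have hts : tsupport (uncurry φ) ⊆ K :=
      closure_minimal (fun z hz => by_contra fun h => hz (hφK z h)) (isClosed_Icc.prod isClosed_closedBall)
    refine hts.trans ?_
    rintro ⟨t, x⟩ hz
    rw [SetLike.mem_coe, mem_slab]
    have := (mem_prod.1 hz).1.2
    show t < 0
    linarith
  have hφ0 : ∀ t x, 0 ≤ φ t x := fun t x => mul_nonneg (hη0 t) (hσ0 _)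
  -- ### the time derivative and the gradient of the test function
  have hTD : ∀ t x, timeDeriv φ t x = η' t * σL (D t • x) + η t * (-c * ⟪D t • x, gL (D t • x)⟫) := by
    intro t x
    rw [timeDeriv_apply]
    show deriv (fun s => η s * σL (D s • x)) t = _
    have hDd : HasDerivAt (fun s => D s • x) ((Real.exp (-(c * t)) * (-c)) • x) t := by
      have h1 : HasDerivAt (fun s => Real.exp (-(c * s))) (Real.exp (-(c * t)) * (-c)) t := by
        have := ((hasDerivAt_id t).const_mul c).neg.exp
        simpa using this
      exact h1.smul_const x
    have hσd : HasDerivAt (fun s => σL (D s • x)) (fderiv ℝ σL (D t • x) ((Real.exp (-(c * t)) * (-c)) • x)) t :=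
      (hσLd _).hasFDerivAt.comp_hasDerivAt t hDd
    have hall := (hηd t).fun_mul hσd
    rw [hall.deriv]
    have hin : fderiv ℝ σL (D t • x) ((Real.exp (-(c * t)) * (-c)) • x) = -c * ⟪D t • x, gL (D t • x)⟫ := by
      have e : (Real.exp (-(c * t)) * (-c)) • x = (-c) • (D t • x) := by
        rw [smul_smul]; congr 1; simp only [hDdef]; ring
      rw [e, map_smul, smul_eq_mul, hgLdef, real_inner_comm, FluidPDE.inner_gradient_left]
    rw [hin]
  have hGR : ∀ t x, gradient (φ t) x = η t • (D t • gL (D t • x)) := by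
    intro t x
    have hd : DifferentiableAt ℝ (fun y => σL (D t • y)) x :=
      (hσLd (D t • x)).comp x (differentiableAt_id.const_smul (D t))
    show gradient (fun y => η t * σL (D t • y)) x = _
    have hcm : gradient (fun y => η t * σL (D t • y)) x = η t • gradient (fun y => σL (D t • y)) x := by
      unfold gradient
      rw [fderiv_const_mul hd (η t), map_smul]
    rw [hcm, hgLdef, gradient_comp_smul]
  -- ### the space integral at each time
  set inner : ℝ → ℝ := fun t => (deriv χ t - 5 * c * χ t) * N + χ t * (-c * J) + χ t * F with hinner
  have hslice : ∀ t : ℝ, ∫ x, (‖u t x‖ ^ 2 * (timeDeriv φ t x + 0 * Δ (φ t) x) +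
      (‖u t x‖ ^ 2 + 2 * p t x) * ⟪u t x, gradient (φ t) x⟫ + 2 * ⟪(0 : ℝ → EuclideanSpace ℝ (Fin 3) → EuclideanSpace ℝ (Fin 3)) t x, u t x⟫ * φ t x) =
      inner t := by
    intro t
    by_cases ht : t < 0
    · -- the integrand is `E^2 g(D t • x)`
      set E : ℝ := Real.exp (c * t) with hE
      have hE0 : 0 < E := Real.exp_pos _
      have hED : E * D t = 1 := by rw [hE, hDdef, ← Real.exp_add, add_neg_cancel, Real.exp_zero]
      set g : EuclideanSpace ℝ (Fin 3) → ℝ := fun z =>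
        ‖V z‖ ^ 2 * (η' t * σL z + η t * (-c * ⟪z, gL z⟫)) + (‖V z‖ ^ 2 + 2 * Q z) * (η t * ⟪V z, gL z⟫) with hg
      have hpt : ∀ x, ‖u t x‖ ^ 2 * (timeDeriv φ t x + 0 * Δ (φ t) x) +
          (‖u t x‖ ^ 2 + 2 * p t x) * ⟪u t x, gradient (φ t) x⟫ +
          2 * ⟪(0 : ℝ → EuclideanSpace ℝ (Fin 3) → EuclideanSpace ℝ (Fin 3)) t x, u t x⟫ * φ t x = E ^ 2 * g (D t • x) := by
        intro x
        have hu2 : ‖u t x‖ ^ 2 = E ^ 2 * ‖V (D t • x)‖ ^ 2 := by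
          rw [hbr t ht x, norm_smul, Real.norm_eq_abs, abs_of_pos hE0, mul_pow]
        have hin : ⟪u t x, gradient (φ t) x⟫ = η t * ⟪V (D t • x), gL (D t • x)⟫ := by
          rw [hbr t ht x, hGR t x, real_inner_smul_left, real_inner_smul_right, real_inner_smul_right]
          calc E * (η t * (D t * ⟪V (D t • x), gL (D t • x)⟫)) = (E * D t) * (η t * ⟪V (D t • x), gL (D t • x)⟫) := by ring
            _ = _ := by rw [hED, one_mul]
        rw [hTD t x, hin, hu2, hp t ht x]
        simp only [Pi.zero_apply, inner_zero_left, mul_zero, zero_mul, add_zero, hg]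
        ring
      have hcv : ∫ x, g (D t • x) = E ^ 3 * ∫ z, g z := by
        have h := Measure.integral_comp_smul volume g (D t)
        have hvol : |((D t ^ Module.finrank ℝ (EuclideanSpace ℝ (Fin 3)))⁻¹)| = E ^ 3 := by
          rw [finrank_euclideanSpace_fin, abs_of_pos (by positivity)]
          have : (D t)⁻¹ = E := by
            rw [hDdef, hE, ← Real.exp_neg, neg_neg]
          rw [← inv_pow, this]
        rw [hvol, smul_eq_mul] at h
        exact h
      have hgint : ∫ z, g z = η' t * N + η t * (-c * J) + η t * F := by
        have e1 : (fun z => g z) = fun z => (η' t * (σL z * ‖V z‖ ^ 2) + (η t * (-c)) * (‖V z‖ ^ 2 * ⟪z, gL z⟫)) +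
            η t * ((‖V z‖ ^ 2 + 2 * Q z) * ⟪V z, gL z⟫) := by
          funext z; simp only [hg]; ring
        have hA : Integrable (fun z => η' t * (σL z * ‖V z‖ ^ 2)) volume := hNi.const_mul _
        have hB : Integrable (fun z => (η t * (-c)) * (‖V z‖ ^ 2 * ⟪z, gL z⟫)) volume := hJi.const_mul _
        have hC : Integrable (fun z => η t * ((‖V z‖ ^ 2 + 2 * Q z) * ⟪V z, gL z⟫)) volume := hFi.const_mul _
        have hAB : Integrable (fun z => η' t * (σL z * ‖V z‖ ^ 2) + (η t * (-c)) * (‖V z‖ ^ 2 * ⟪z, gL z⟫)) volume :=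
          hA.add hB
        have i1 : ∫ z, (η' t * (σL z * ‖V z‖ ^ 2) + (η t * (-c)) * (‖V z‖ ^ 2 * ⟪z, gL z⟫)) +
            η t * ((‖V z‖ ^ 2 + 2 * Q z) * ⟪V z, gL z⟫) =
            (∫ z, η' t * (σL z * ‖V z‖ ^ 2) + (η t * (-c)) * (‖V z‖ ^ 2 * ⟪z, gL z⟫)) +
              ∫ z, η t * ((‖V z‖ ^ 2 + 2 * Q z) * ⟪V z, gL z⟫) := integral_add hAB hC
        have i2 : ∫ z, η' t * (σL z * ‖V z‖ ^ 2) + (η t * (-c)) * (‖V z‖ ^ 2 * ⟪z, gL z⟫) =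
            (∫ z, η' t * (σL z * ‖V z‖ ^ 2)) + ∫ z, (η t * (-c)) * (‖V z‖ ^ 2 * ⟪z, gL z⟫) := integral_add hA hB
        have i3 : ∫ z, η' t * (σL z * ‖V z‖ ^ 2) = η' t * N := integral_const_mul _ _
        have i4 : ∫ z, (η t * (-c)) * (‖V z‖ ^ 2 * ⟪z, gL z⟫) = (η t * (-c)) * J := integral_const_mul _ _
        have i5 : ∫ z, η t * ((‖V z‖ ^ 2 + 2 * Q z) * ⟪V z, gL z⟫) = η t * F := integral_const_mul _ _
        rw [e1, i1, i2, i3, i4, i5]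
        ring
      rw [integral_congr_ae (Eventually.of_forall hpt), integral_const_mul, hcv, hgint]
      simp only [hinner]
      have e5 : E ^ 2 * (E ^ 3 * (η' t * N + η t * (-c * J) + η t * F)) =
          (E ^ 5 * η' t) * N + (E ^ 5 * η t) * (-c * J) + (E ^ 5 * η t) * F := by ring
      rw [e5, hEη t, hEη' t]
    · -- `t ≥ 0`: everything vanishes
      have ht' : t ∉ Icc (-7/4 : ℝ) (-5/4) := fun h => ht (by linarith [h.2])
      have hφ0' : ∀ x, φ t x = 0 := fun x => by simp only [hφdef, hηsupp t ht', zero_mul]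
      have hpt : ∀ x, ‖u t x‖ ^ 2 * (timeDeriv φ t x + 0 * Δ (φ t) x) +
          (‖u t x‖ ^ 2 + 2 * p t x) * ⟪u t x, gradient (φ t) x⟫ +
          2 * ⟪(0 : ℝ → EuclideanSpace ℝ (Fin 3) → EuclideanSpace ℝ (Fin 3)) t x, u t x⟫ * φ t x = 0 := by
        intro x
        rw [hTD t x, hGR t x, hηsupp t ht', hη'supp t ht']
        simp
      rw [integral_congr_ae (Eventually.of_forall hpt), integral_zero]
      simp only [hinner, hχsupp t ht', hχ'supp t ht']
      ring
  -- ### the local energy inequality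
  obtain ⟨G₀, -, -, hLEI⟩ := hsw.localEnergy
  have hineq := hLEI φ hφT hφ0
  have hlhs : (2 : ℝ) * 0 * ∫ t, ∫ x, frobeniusNormSq (G₀ t x) * φ t x = 0 := by ring
  rw [hlhs] at hineq
  have hrhs : (∫ t, ∫ x, (‖u t x‖ ^ 2 * (timeDeriv φ t x + 0 * Δ (φ t) x) +
      (‖u t x‖ ^ 2 + 2 * p t x) * ⟪u t x, gradient (φ t) x⟫ +
      2 * ⟪(0 : ℝ → EuclideanSpace ℝ (Fin 3) → EuclideanSpace ℝ (Fin 3)) t x, u t x⟫ * φ t x)) = ∫ t, inner t :=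
    integral_congr_ae (Eventually.of_forall hslice)
  rw [hrhs] at hineq
  -- ### the time integral
  have htime : ∫ t, inner t = (∫ t, χ t) * (-(5 * c) * N + (-c * J) + F) := by
    have e1 : inner = fun t => N * deriv χ t + (-(5 * c) * N + (-c * J) + F) * χ t := by
      funext t; simp only [hinner]; ring
    have hA : Integrable (fun t => N * deriv χ t) volume := hχ'i.const_mul _
    have hB : Integrable (fun t => (-(5 * c) * N + (-c * J) + F) * χ t) volume := hχi.const_mul _
    have i1 : ∫ t, N * deriv χ t + (-(5 * c) * N + (-c * J) + F) * χ t =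
        (∫ t, N * deriv χ t) + ∫ t, (-(5 * c) * N + (-c * J) + F) * χ t := integral_add hA hB
    have i2 : ∫ t, N * deriv χ t = N * ∫ t, deriv χ t := integral_const_mul _ _
    have i3 : ∫ t, (-(5 * c) * N + (-c * J) + F) * χ t = (-(5 * c) * N + (-c * J) + F) * ∫ t, χ t :=
      integral_const_mul _ _
    rw [e1, i1, i2, i3, hχ'0]
    ring
  rw [htime] at hineq
  have hkey : 0 ≤ -(5 * c) * N + (-c * J) + F := by
    by_contra h
    push Not at h
    have := mul_neg_of_pos_of_neg hχpos h
    linarith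
  simp only [hN, hJ, hF] at hkey
  linarith

end BreatherWeak

end Summit.NavierStokesRegularity.NavierStokesRegularity.Theorems.PowerGaugeEulerLiouville

end
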